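import Mathlib
import HarnessLib
import Summits.ValiantsHypothesis.ValiantsHypothesis.Theorems.LacunarySymmetroidMatrixDescartesProductPlusOneEulerRolle
import Summits.ValiantsHypothesis.ValiantsHypothesis.Theorems.LacunarySymmetroidMatrixDescartesProductPlusOneRowCalibration

/-!
# ValiantsHypothesis / LacunarySymmetroid — crux `MatrixDescartes` (stmt-ValiantsHypothesis-18050, V1),
# LINE (A) «product_plus_one» (`Cruxes/MatrixDescartes/Lines/product_plus_one.lean` @a0cf3f5276f3):
# the research stubs `stub_classRowK3` / `stub_polyLaw` REDUCED to ONE coupling-free positive-zero count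

Composition of the two bookkeeping files of this lane (`…ProductPlusOneEulerRolle`: `Z₊(member) ≤ 1 + Z₊(R)`, and
`…ProductPlusOneRowCalibration`: `Z ≤ 2·Z₊ + 1` by the `x ↦ −x` closure of the class), stated so that the line owner can
re-cut the research stubs through it:

* `ppoLawAt_of_eulerBound` — if, at format `(m, K)`, the c-FREE sparse sum-of-products
  `R(d, a, l₀) = Σ_j (Σ_l a_{jl}(d_l − d_{l₀}) X^{d_l}) · ∏_{i≠j} (Σ_l a_{il} X^{d_l})` has at most `B` distinct positive zeros for
  every support `d`, coefficients `a` and coupled letter `l₀`, then the line's row `PPOLawAt m K (2B + 3)` holds (UNFOLDED verbatim);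
* `classRowK3_of_eulerBound` — hence a bound `B = C₀·m + C₀` at `K = 3` gives the line's `ClassRowK3Linear` (UNFOLDED verbatim:
  `∃ C, ∀ m, PPOLawAt m 3 (C·m + C)`, with `C = 2C₀ + 3`), and
* `ppoPolyLaw_of_eulerBound` — a bound `B = (mK+2)^C₀` gives the line's `PPOPolyLaw` (UNFOLDED verbatim, exponent `C₀ + 3`).

So the research content of LINE (A) is exactly: «the logarithmic-derivative numerator `R` of a product of `m` `K`-nomials on a
common support (one letter removed per summand by `θ − d_{l₀}`) has `O(m)` (resp. `poly(mK)`) positive zeros, uniformly in the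
support» — no coupling constant, no negative zeros, no zero at the origin left to treat.

HONEST FRAMING: a reduction (both directions of bookkeeping are kernel theorems; the analytic count is the OPEN hypothesis);
NOT `stub_classRowK3`, not `stub_polyLaw`, not `ProductPlusOneMDR`, not `MatrixDescartes`, not Conjecture B; `VP ≠ VNP` is NOT
proved.  No definitions, no named facts; Mathlib + the two lane files.
-/

-- `Summit.ValiantsHypothesis.ValiantsHypothesis.…` is the tree's mandated single-conjunct layout (Sub = Summit).
set_option linter.dupNamespace false

namespace Summit.ValiantsHypothesis.ValiantsHypothesis.Theorems.LacunarySymmetroidMatrixDescartes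

namespace ProductPlusOne

open Polynomial Finset
open scoped BigOperators

/-- **Row from a bound on the Euler-derivative numerator** (the line's `PPOLawAt m K (2B+3)` UNFOLDED verbatim): if
`Z₊(Σ_j B_j ∏_{i≠j} f_i) ≤ B` for every support, coefficients and coupled letter at format `(m, K)`, then every member has at most
`2B + 3` distinct real zeros. [this file's theorem] -/
theorem ppoLawAt_of_eulerBound (m K B : ℕ)
    (h : ∀ (d : Fin K → ℕ) (a : Fin m → Fin K → ℝ) (l₀ : Fin K),
      ((∑ j, (∑ l, C (a j l * ((d l : ℝ) - d l₀)) * X ^ (d l)) * ∏ i ∈ Finset.univ.erase j, ∑ l, C (a i l) * X ^ (d l)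
          : ℝ[X]).roots.toFinset.filter (fun t => 0 < t)).card ≤ B) :
    ∀ (d : Fin K → ℕ) (a : Fin m → Fin K → ℝ) (l₀ : Fin K) (c : ℝ),
      (C c * X ^ (m * d l₀) + ∏ j, ∑ l, C (a j l) * X ^ (d l) : ℝ[X]).roots.toFinset.card ≤ 2 * (B + 1) + 1 :=
  ppoLawAt_of_pos_count m K (B + 1) (fun d a l₀ c =>
    (card_pos_roots_class_le_euler d a l₀ c).trans (Nat.add_le_add_right (h d a l₀) 1))

/-- **`stub_classRowK3` reduced** (the line's `ClassRowK3Linear` UNFOLDED verbatim): a linear bound `C₀·m + C₀` on the positive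
zeros of the Euler-derivative numerator at `K = 3` gives `∃ C, ∀ m, PPOLawAt m 3 (C·m + C)` (`C = 2C₀ + 3`). [this file's theorem] -/
theorem classRowK3_of_eulerBound (C₀ : ℕ)
    (h : ∀ (m : ℕ) (d : Fin 3 → ℕ) (a : Fin m → Fin 3 → ℝ) (l₀ : Fin 3),
      ((∑ j, (∑ l, C (a j l * ((d l : ℝ) - d l₀)) * X ^ (d l)) * ∏ i ∈ Finset.univ.erase j, ∑ l, C (a i l) * X ^ (d l)
          : ℝ[X]).roots.toFinset.filter (fun t => 0 < t)).card ≤ C₀ * m + C₀) :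
    ∃ C₁ : ℕ, ∀ (m : ℕ) (d : Fin 3 → ℕ) (a : Fin m → Fin 3 → ℝ) (l₀ : Fin 3) (c : ℝ),
      (C c * X ^ (m * d l₀) + ∏ j, ∑ l, C (a j l) * X ^ (d l) : ℝ[X]).roots.toFinset.card ≤ C₁ * m + C₁ := by
  refine ⟨2 * C₀ + 3, fun m d a l₀ c => ?_⟩
  have h1 := ppoLawAt_of_eulerBound m 3 (C₀ * m + C₀) (h m) d a l₀ c
  have h2 : 2 * (C₀ * m + C₀ + 1) + 1 ≤ (2 * C₀ + 3) * m + (2 * C₀ + 3) := by nlinarith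
  exact h1.trans h2

/-- **`stub_polyLaw` reduced** (the line's `PPOPolyLaw` UNFOLDED verbatim): a polynomial bound `(mK+2)^C₀` on the positive zeros
of the Euler-derivative numerator gives `∃ C, ∀ m K, PPOLawAt m K ((mK+2)^C)` (`C = C₀ + 3`). [this file's theorem] -/
theorem ppoPolyLaw_of_eulerBound (C₀ : ℕ)
    (h : ∀ (m K : ℕ) (d : Fin K → ℕ) (a : Fin m → Fin K → ℝ) (l₀ : Fin K),
      ((∑ j, (∑ l, C (a j l * ((d l : ℝ) - d l₀)) * X ^ (d l)) * ∏ i ∈ Finset.univ.erase j, ∑ l, C (a i l) * X ^ (d l)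
          : ℝ[X]).roots.toFinset.filter (fun t => 0 < t)).card ≤ (m * K + 2) ^ C₀) :
    ∃ C₁ : ℕ, ∀ (m K : ℕ) (d : Fin K → ℕ) (a : Fin m → Fin K → ℝ) (l₀ : Fin K) (c : ℝ),
      (C c * X ^ (m * d l₀) + ∏ j, ∑ l, C (a j l) * X ^ (d l) : ℝ[X]).roots.toFinset.card ≤ (m * K + 2) ^ C₁ := by
  refine ⟨C₀ + 3, fun m K d a l₀ c => ?_⟩
  have h1 := ppoLawAt_of_eulerBound m K ((m * K + 2) ^ C₀) (h m K) d a l₀ c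
  have h2 : 2 * ((m * K + 2) ^ C₀ + 1) + 1 ≤ (m * K + 2) ^ (C₀ + 3) := by
    have hp : 1 ≤ (m * K + 2) ^ C₀ := Nat.one_le_pow _ _ (by omega)
    have h8 : 8 ≤ (m * K + 2) ^ 3 := by
      have hx : 2 ≤ m * K + 2 := by omega
      calc 8 = 2 ^ 3 := by norm_num
        _ ≤ (m * K + 2) ^ 3 := Nat.pow_le_pow_left hx 3
    have e : (m * K + 2) ^ (C₀ + 3) = (m * K + 2) ^ C₀ * (m * K + 2) ^ 3 := by rw [← pow_add]
    rw [e]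
    calc 2 * ((m * K + 2) ^ C₀ + 1) + 1 ≤ 8 * (m * K + 2) ^ C₀ := by linarith
      _ = (m * K + 2) ^ C₀ * 8 := by ring
      _ ≤ (m * K + 2) ^ C₀ * (m * K + 2) ^ 3 := Nat.mul_le_mul_left _ h8
  exact h1.trans h2

end ProductPlusOne

end Summit.ValiantsHypothesis.ValiantsHypothesis.Theorems.LacunarySymmetroidMatrixDescartes
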